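import Literature.Probability.LatticeModels.RandomClusterRayleighSeriesParallel
import Literature.Probability.LatticeModels.RandomClusterTwoTreeEdgeNegativeCorrelation
import HarnessLib

/-!
# Wagner 2008 (graph case): `φ_{w,q}`, `0 < q ≤ 1`, is edge-negatively associated on `K₄`-minor-free weighted graphs — `Wagner2008_rc_edgeNegCorr_of_noK4Minor` HOLDS (re-homed proofs, file 2 of 2)

**Wagner 2008 (graph case): for `0 < q ≤ 1` the random-cluster measure `φ_{w,q}` is EDGE-NEGATIVELY ASSOCIATED on every weighted
graph whose support has no `K₄` minor — the named fact `Literature.Probability.LatticeModels.Wagner2008_rc_edgeNegCorr_of_noK4Minor`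
(`RandomClusterRayleighSeriesParallel.lean`) HOLDS**: `φ_{w,q}(J_e ∩ J_f) ≤ φ_{w,q}(J_e)·φ_{w,q}(J_f)` for all pairs `f ≠ e`, `e` not a
loop (D. G. Wagner, *Negatively correlated random variables and Mason's conjecture for independent sets in matroids*, Ann. Comb. 12
(2008) 211–239 = arXiv:math/0602648, Ex. 5.1, Thm. 5.8(d), §5.2–5.3 [Wagner2006]: the Potts–Rayleigh class contains all series–parallel
graphs; G. Grimmett, *The Random-Cluster Model* (2006), §3.9 eq. (3.94) [Grimmett2006]; the finite graphs without a `K₄` minor are the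
partial 2-trees — Dirac 1952 / Duffin 1965, R. Diestel, *Graph Theory*, §7.3 [Diestel2017]).  ARCHITECTURE of the in-tree proof
(kernel-checked; until now Summits-side only, `Summits/CriticalPhenomena/PercolationContinuityZ3/Theorems/Transplant/FKConnectivityAllQWagner.lean`):
(1) `FK.edgeNegCorrSupp_of_isTwoTree` — negative edge correlation for every weight vector supported inside a 2-TREE, by apex
elimination (a vertex-level form of Wagner's two-sum induction, Thm. 5.8(d)): affine dependence of the weights on one edge parameter,
edge toggling identities, the local criterion `edgeConnMono_of_negCorr_at`, apex tools / mass / cases / step; (2)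
`K4Free.exists_superset_of_not_hasK4Minor` — a finite graph without a `K₄` minor (branch sets) lies inside a 2-tree (Dirac's lemma by
the rotation descent on a longest path, suppression of degree-two vertices); (3) loop erasure (`FK…Loops`) — diagonal pairs are
independent coins.  RE-HOMED into `Literature/` by the Hodge foundations lane (`lit-hodgefound`, seat p20, generation 38): verbatim
DECLARATION-LEVEL ports (the declarations needed, in dependency order) of the 16 Summits modules
`…/Theorems/Transplant/{FKConnectivityAllQ{Defs,EdgeMono,EdgeToggle,EdgeLocal,ApexTools,ApexMass,ApexCases,ApexStep,TwoTree,Loops,Wagner},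
K4MinorFree{Defs,Paths,Dirac}}.lean` and `…/Theorems/PercNearOneGluingNoHeavyLowerTail{FKHullPortTASections,CoSunflowerGlue}.lean`,
namespace `Summit.CriticalPhenomena.PercolationContinuityZ3.Theorems` re-rooted as `Literature.Probability.LatticeModels.RandomClusterRayleigh`
(sub-namespaces `FK`, `K4Free`, `CoSunflowerGlue` kept), followed by the EXACT-name discharge
`Literature.Probability.LatticeModels.Wagner2008_rc_edgeNegCorr_of_noK4Minor_holds`.  The honest definitions of the source come along
with their bodies (`FK.IsTwoTree` (inductive), `FK.EdgeNegCorrSupp`, `K4Free.IsPathSeq` (structure), `K4Free.IsLongest`, `K4Free.rot`,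
`K4Free.seg`, `K4Free.delVert`, `K4Free.ThreeNeighbours` — combinatorial notions with 1–3-line bodies, each cited); no new named fact
(D-0026), no Summits import; every declaration carries a citation.  Built on the tree's Literature layer
(`Probability/LatticeModels/RandomCluster{EdgeWeights,FKG,RayleighSeriesParallel}`, `Probability/Percolation/*`) and Mathlib.  The
Summits originals stay in place (transitional duplication; they belong to the post-continuity programme built on p205010).  WHAT THIS
IS NOT: nothing here bears on continuity of the percolation probability in `ℤ³` or any critical phenomenon; this is finite
random-cluster combinatorics and the graph theory of `K₄`-minor-free graphs.

THIS FILE (2 of 2; imports `RandomClusterTwoTreeEdgeNegativeCorrelation.lean`): loop erasure, `K₄`-minor-free graphs are partial 2-trees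
(Dirac's lemma by rotation descent), and the EXACT-name discharge.
-/

noncomputable section

/-!
## Part 1 — port of `Summits/CriticalPhenomena/PercolationContinuityZ3/Theorems/Transplant/FKConnectivityAllQLoops.lean` (12 declarations kept)

# Connectivity correlation inequalities for `φ_{w,q}`, every `q > 0` — loop erasure: diagonal pairs are independent coins

Verbatim declaration-level port (the declarations listed in the Part header count) of a helper module of the
PercolationContinuityZ3 tree (FK sub-lane); route bookkeeping of the source docstring is not reproduced.

The tree's random-cluster measure `rcMeasureW w q ∅` (Grimmett's (1.20)) lives on configurations `ω ⊆ Sym2 V` INCLUDING the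
diagonal pairs `s(x,x)` (loops).  A loop never changes the cluster count, so it is an independent `Bernoulli(w_{xx})` coin: for an
event `F` insensitive to the loop, `φ_w(F) = φ_{w[xx ↦ 0]}(F)`, and `φ_w(J_e ∩ J_{xx}) = φ_w(J_e)·φ_w(J_{xx})`.  This bookkeeping
is what lets a statement about weight vectors whose SUPPORT GRAPH (`SimpleGraph.fromEdgeSet`, which ignores loops) is
series–parallel — the named fact `Wagner2008_rc_edgeNegCorr_of_noK4Minor` — be reduced to weight vectors supported on the
nondiagonal pairs of a 2-tree (`FK.rc_edgeNegCorr_of_isTwoTree`).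
* `FK.sum_rcWeightW_update_loop` / `FK.rcPartitionFunctionW_update_loop` — `S_{w[xx↦1]}(F) = S_{w[xx↦0]}(F)` for `F`
  insensitive to `s(x,x)`, and `Z_{w[xx↦1]} = Z_{w[xx↦0]}` (toggle identity of `…EdgeToggle` at `x = y`);
* `FK.rcMeasureW_real_update_loop_zero` — `φ_w(F) = φ_{w[xx↦0]}(F)` for such `F`;
* `FK.rcMeasureW_real_eraseLoops` — `φ_w(F) = φ_{w°}(F)` where `w°` zeroes every diagonal pair, for `F` insensitive to loops;
* `FK.rcMeasureW_real_inter_loop` — `φ_w(J_e ∩ J_{xx}) = φ_w(J_e)·φ_w(J_{xx})` (`e ≠ s(x,x)`).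
[cite: Grimmett2006, §1.4 eq. (1.20) (p. 15); Thm. (3.1)(a) (p. 37)]
-/

section Part1

namespace Literature.Probability.LatticeModels.RandomClusterRayleigh

namespace FK

open _root_.MeasureTheory _root_.Set Literature.Probability.LatticeModels Literature.Probability.Percolation
open Literature.Probability.Percolation.DecisionTree (ind ind_of_not_mem)
open scoped _root_.Classical symmDiff

variable {V : Type*} [Fintype V]

/-! ### One loop -/

omit [Fintype V] in
/-- The complement of `{x ↔ x}` is empty. [cite: Grimmett2006, §1.4 eq. (1.20) (p. 15); Thm. (3.1)(a) (p. 37)] -/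
theorem compl_openConn_self (x : V) : (openConn x x : Set (BondConfig V))ᶜ = ∅ :=
  Set.compl_empty_iff.2 (Set.eq_univ_of_forall fun ω => (mem_openConn_iff' x x ω).2 (SimpleGraph.Reachable.refl x))

/-- **A loop is a free coin (masses)**: for `F` insensitive to the loop `s(x,x)`, `S_{w[xx↦1]}(F) = S_{w[xx↦0]}(F)`.
[cite: Grimmett2006, Thm. (3.1)(a) (p. 37); §1.4 eq. (1.20) (p. 15)] -/
theorem sum_rcWeightW_update_loop (w : Sym2 V → unitInterval) {q : ℝ} (hq : q ≠ 0) (x : V) (F : Set (BondConfig V))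
    (hF : ∀ ω : BondConfig V, ω ∆ {s(x, x)} ∈ F ↔ ω ∈ F) :
    ∑ ω : BondConfig V, rcWeightW (Function.update w s(x, x) 1) q ∅ ω * ind F ω =
      ∑ ω : BondConfig V, rcWeightW (Function.update w s(x, x) 0) q ∅ ω * ind F ω := by
  rw [sum_rcWeightW_update_one_eq_toggle w hq x x F hF, compl_openConn_self, Set.inter_empty]
  have h0 : ∑ ω : BondConfig V, rcWeightW (Function.update w s(x, x) 0) q ∅ ω * ind (∅ : Set (BondConfig V)) ω = 0 :=
    Finset.sum_eq_zero fun ω _ => by rw [ind_of_not_mem (Set.notMem_empty ω), mul_zero]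
  rw [h0, mul_zero, add_zero]

/-- **A loop is a free coin (partition function)**: `Z_{w[xx↦1]} = Z_{w[xx↦0]}`. [cite: Grimmett2006, Thm. (3.1)(a) (p. 37)] -/
theorem rcPartitionFunctionW_update_loop (w : Sym2 V → unitInterval) {q : ℝ} (hq : q ≠ 0) (x : V) :
    rcPartitionFunctionW (Function.update w s(x, x) 1) q ∅ = rcPartitionFunctionW (Function.update w s(x, x) 0) q ∅ := by
  rw [rcPartitionFunctionW_update_one_eq_toggle w hq x x, compl_openConn_self]
  have h0 : ∑ ω : BondConfig V, rcWeightW (Function.update w s(x, x) 0) q ∅ ω * ind (∅ : Set (BondConfig V)) ω = 0 :=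
    Finset.sum_eq_zero fun ω _ => by rw [ind_of_not_mem (Set.notMem_empty ω), mul_zero]
  rw [h0, mul_zero, add_zero]

/-- Masses of loop-insensitive events do not depend on the loop parameter: `S_w(F) = S_{w[xx↦0]}(F)`.
[cite: Grimmett2006, §1.4 eq. (1.20) (p. 15)] -/
theorem sum_rcWeightW_loop_eq_zero (w : Sym2 V → unitInterval) {q : ℝ} (hq : q ≠ 0) (x : V) (F : Set (BondConfig V))
    (hF : ∀ ω : BondConfig V, ω ∆ {s(x, x)} ∈ F ↔ ω ∈ F) :
    ∑ ω : BondConfig V, rcWeightW w q ∅ ω * ind F ω =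
      ∑ ω : BondConfig V, rcWeightW (Function.update w s(x, x) 0) q ∅ ω * ind F ω := by
  rw [sum_rcWeightW_ind_affine w q s(x, x) F, sum_rcWeightW_update_loop w hq x F hF]
  ring

/-- The partition function does not depend on loop parameters: `Z_w = Z_{w[xx↦0]}`. [cite: Grimmett2006, §1.4 eq. (1.20) (p. 15)] -/
theorem rcPartitionFunctionW_loop_eq_zero (w : Sym2 V → unitInterval) {q : ℝ} (hq : q ≠ 0) (x : V) :
    rcPartitionFunctionW w q ∅ = rcPartitionFunctionW (Function.update w s(x, x) 0) q ∅ := by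
  rw [rcPartitionFunctionW_affine w q s(x, x), rcPartitionFunctionW_update_loop w hq x]
  ring

/-- **Loop erasure, one loop**: `φ_w(F) = φ_{w[xx↦0]}(F)` for every event `F` insensitive to the loop `s(x,x)`.
[cite: Grimmett2006, §1.4 eq. (1.20) (p. 15); Thm. (3.1)(a) (p. 37)] -/
theorem rcMeasureW_real_update_loop_zero (w : Sym2 V → unitInterval) {q : ℝ} (hq : 0 < q) (x : V)
    (F : Set (BondConfig V)) (hF : ∀ ω : BondConfig V, ω ∆ {s(x, x)} ∈ F ↔ ω ∈ F) :
    (rcMeasureW w q ∅).real F = (rcMeasureW (Function.update w s(x, x) 0) q ∅).real F := by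
  rw [rcMeasureW_real_eq_sum_div w hq ∅ F, rcMeasureW_real_eq_sum_div _ hq ∅ F,
    sum_rcWeightW_loop_eq_zero w hq.ne' x F hF, rcPartitionFunctionW_loop_eq_zero w hq.ne' x]

/-- **A loop is independent of everything else**: `φ_w(J_{xx} ∩ J_e)·1 = φ_w(J_{xx})·φ_w(J_e)` — precisely,
`φ_w({xx ∈ ω} ∩ {e ∈ ω}) = φ_w({e ∈ ω})·φ_w({xx ∈ ω})` for every pair `e ≠ s(x,x)`.
[cite: Grimmett2006, §1.4 eq. (1.20) (p. 15); Thm. (3.1)(a) (p. 37)] -/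
theorem rcMeasureW_real_inter_loop (w : Sym2 V → unitInterval) {q : ℝ} (hq : 0 < q) (x : V) {e : Sym2 V}
    (he : e ≠ s(x, x)) :
    (rcMeasureW w q ∅).real ({ω | e ∈ ω} ∩ {ω | s(x, x) ∈ ω}) =
      (rcMeasureW w q ∅).real {ω | e ∈ ω} * (rcMeasureW w q ∅).real {ω | s(x, x) ∈ ω} := by
  have hZ := rcPartitionFunctionW_pos w hq (∅ : Set V)
  have hq' := hq.ne'
  -- `J_e` is insensitive to the loop
  have hJe : ∀ ω : BondConfig V, ω ∆ {s(x, x)} ∈ {ω : BondConfig V | e ∈ ω} ↔ ω ∈ {ω : BondConfig V | e ∈ ω} := by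
    intro ω
    simp only [Set.mem_setOf_eq, Set.mem_symmDiff, Set.mem_singleton_iff]
    constructor
    · rintro (⟨h, -⟩ | ⟨h, -⟩)
      · exact h
      · exact (he h).elim
    · intro h; exact Or.inl ⟨h, he⟩
  rw [Set.inter_comm, rcMeasureW_real_eq_sum_div w hq ∅, rcMeasureW_real_eq_sum_div w hq ∅,
    rcMeasureW_real_eq_sum_div w hq ∅, sum_rcWeightW_ind_inter_openPair w q s(x, x) {ω | e ∈ ω},
    sum_rcWeightW_ind_openPair w q s(x, x), sum_rcWeightW_update_loop w hq' x _ hJe,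
    ← sum_rcWeightW_loop_eq_zero w hq' x _ hJe, rcPartitionFunctionW_update_loop w hq' x,
    ← rcPartitionFunctionW_loop_eq_zero w hq' x]
  field_simp

/-! ### All loops at once -/

omit [Fintype V] in
/-- Zeroing the parameters of the pairs in a finite set `D`. [cite: Grimmett2006, §1.4 eq. (1.20) (p. 15); Thm. (3.1)(a) (p. 37)] -/
theorem update_zeroOn_insert (w : Sym2 V → unitInterval) (D : Finset (Sym2 V)) (ℓ : Sym2 V) :
    (fun e => if e ∈ insert ℓ D then (0 : unitInterval) else w e) =
      Function.update (fun e => if e ∈ D then (0 : unitInterval) else w e) ℓ 0 := by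
  funext e
  by_cases h : e = ℓ
  · subst h; simp
  · rw [Function.update_of_ne h]
    simp [Finset.mem_insert, h]

/-- **Loop erasure on a set of loops**: zeroing the parameters of any finite set `D` of DIAGONAL pairs does not change the
probability of an event insensitive to every loop. [cite: Grimmett2006, §1.4 eq. (1.20) (p. 15)] -/
theorem rcMeasureW_real_zeroOn_diag (w : Sym2 V → unitInterval) {q : ℝ} (hq : 0 < q) (F : Set (BondConfig V))
    (hF : ∀ x : V, ∀ ω : BondConfig V, ω ∆ {s(x, x)} ∈ F ↔ ω ∈ F) :
    ∀ D : Finset (Sym2 V), (∀ ℓ ∈ D, ℓ.IsDiag) →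
      (rcMeasureW w q ∅).real F = (rcMeasureW (fun e => if e ∈ D then (0 : unitInterval) else w e) q ∅).real F := by
  intro D
  induction D using Finset.induction_on with
  | empty => intro _; simp
  | insert ℓ D hℓ ih =>
    intro hD
    rw [ih fun ℓ' hℓ' => hD ℓ' (Finset.mem_insert_of_mem hℓ'), update_zeroOn_insert]
    have hdiag := hD ℓ (Finset.mem_insert_self _ _)
    induction ℓ using Sym2.ind with
    | h x y =>
      have hxy : x = y := Sym2.mk_isDiag_iff.1 hdiag
      subst hxy
      exact rcMeasureW_real_update_loop_zero _ hq x F (hF x)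

/-- **Loop erasure**: with `w° e = 0` on diagonal pairs and `w° e = w e` otherwise, `φ_w(F) = φ_{w°}(F)` for every event `F`
insensitive to every loop. [cite: Grimmett2006, §1.4 eq. (1.20) (p. 15); Thm. (3.1)(a) (p. 37)] -/
theorem rcMeasureW_real_eraseLoops (w : Sym2 V → unitInterval) {q : ℝ} (hq : 0 < q) (F : Set (BondConfig V))
    (hF : ∀ x : V, ∀ ω : BondConfig V, ω ∆ {s(x, x)} ∈ F ↔ ω ∈ F) :
    (rcMeasureW w q ∅).real F = (rcMeasureW (fun e => if e.IsDiag then (0 : unitInterval) else w e) q ∅).real F := by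
  have h := rcMeasureW_real_zeroOn_diag w hq F hF (Finset.univ.filter fun e : Sym2 V => e.IsDiag)
    (fun ℓ hℓ => (Finset.mem_filter.1 hℓ).2)
  rw [h]
  congr 2
  funext e
  simp [Finset.mem_filter]

omit [Fintype V] in
/-- The event `{e ∈ ω}` is insensitive to every loop other than `e`. [cite: Grimmett2006, §1.4 eq. (1.20) (p. 15); Thm. (3.1)(a) (p. 37)] -/
theorem openPair_loop_insensitive {e : Sym2 V} (he : ¬ e.IsDiag) (x : V) (ω : BondConfig V) :
    ω ∆ {s(x, x)} ∈ {ω : BondConfig V | e ∈ ω} ↔ ω ∈ {ω : BondConfig V | e ∈ ω} := by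
  have hne : e ≠ s(x, x) := fun h => he (h ▸ Sym2.mk_isDiag_iff.2 rfl)
  simp only [Set.mem_setOf_eq, Set.mem_symmDiff, Set.mem_singleton_iff]
  constructor
  · rintro (⟨h, -⟩ | ⟨h, -⟩)
    · exact h
    · exact (hne h).elim
  · intro h; exact Or.inl ⟨h, hne⟩

omit [Fintype V] in
/-- The event `{e ∈ ω} ∩ {f ∈ ω}` is insensitive to every loop when `e`, `f` are not loops. [cite: Grimmett2006, §1.4 eq. (1.20) (p. 15); Thm. (3.1)(a) (p. 37)] -/
theorem openPair_inter_loop_insensitive {e f : Sym2 V} (he : ¬ e.IsDiag) (hf : ¬ f.IsDiag) (x : V) (ω : BondConfig V) :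
    ω ∆ {s(x, x)} ∈ ({ω : BondConfig V | e ∈ ω} ∩ {ω | f ∈ ω}) ↔ ω ∈ ({ω : BondConfig V | e ∈ ω} ∩ {ω | f ∈ ω}) := by
  rw [Set.mem_inter_iff, Set.mem_inter_iff, openPair_loop_insensitive he, openPair_loop_insensitive hf]

end FK

end Literature.Probability.LatticeModels.RandomClusterRayleigh

end Part1

/-!
## Part 2 — port of `Summits/CriticalPhenomena/PercolationContinuityZ3/Theorems/Transplant/K4MinorFreeDefs.lean` (13 declarations kept)

# `K₄`-minor-free graphs are partial 2-trees — file 1: definitions (path sequences, rotation, segments, vertex deletion)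

Verbatim declaration-level port (the declarations listed in the Part header count) of a helper module of the
PercolationContinuityZ3 tree (FK sub-lane); route bookkeeping of the source docstring is not reproduced.
(Wagner 2008, graph case; `Literature/Probability/LatticeModels/RandomClusterRayleighSeriesParallel.lean`) needs the
classical STRUCTURE THEOREM "a finite graph without a `K₄` minor is a subgraph of a 2-tree" (Dirac 1952 / Duffin 1965 /
Wald–Colbourn 1983; Diestel, Graph Theory, §7.3), so that kernel theorem `FK.rc_edgeNegCorr_of_isTwoTree` (negative edge correlation of
`φ_{w,q}`, `0 < q ≤ 1`, on 2-tree supports) applies to every `K₄`-minor-free support.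

This file: the (few) definitions used by the proof, with their unfolding lemmas —
* `K4Free.IsPathSeq G f m` — `f 0, …, f m` is a path (consecutive adjacent, pairwise distinct); `K4Free.IsLongest`;
* `K4Free.rot f i` — the Pósa rotation (reverse the prefix `f 0 … f (i-1)`); `K4Free.seg f lo hi = f '' [lo, hi]`;
* `K4Free.delVert G v` — `G` with the edges at `v` deleted; `K4Free.ThreeNeighbours G` — every non-isolated vertex has three
  distinct neighbours; `K4Free.hasK4Minor_of_le` — monotonicity of `HasK4Minor` (branch sets).
The theorems are in `…K4MinorFreePaths.lean` (longest paths, rotation, `K₄` minors from path segments) and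
`…K4MinorFreeDirac.lean` (Dirac's lemma, suppression of degree-two vertices, embedding into a 2-tree).
[cite: Diestel2017, §7.3 (Prop. 7.3.1, Cor. 7.3.2); §1.7 (minors)] [cite: Wagner2006, §5.3]
-/

section Part2

namespace Literature.Probability.LatticeModels.RandomClusterRayleigh

namespace K4Free

open Literature.Probability.LatticeModels (HasK4Minor)

variable {V : Type*}

/-! ### Definitions -/

/-- A path of length `m` in `G` presented as a sequence: `f 0, …, f m` are pairwise distinct and consecutive
terms are adjacent (values of `f` beyond `m` are irrelevant). [cite: Diestel2017, §7.3 (Prop. 7.3.1, Cor. 7.3.2); §1.7 (minors)] -/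
structure IsPathSeq (G : SimpleGraph V) (f : ℕ → V) (m : ℕ) : Prop where
  /-- consecutive vertices are adjacent -/
  adj : ∀ t, t < m → G.Adj (f t) (f (t + 1))
  /-- the vertices are pairwise distinct -/
  inj : ∀ s t, s ≤ m → t ≤ m → f s = f t → s = t

/-- A longest path of `G`: a path sequence of length `m` such that no path sequence is longer. [cite: Diestel2017, §7.3 (Prop. 7.3.1, Cor. 7.3.2); §1.7 (minors)] -/
def IsLongest (G : SimpleGraph V) (f : ℕ → V) (m : ℕ) : Prop :=
  IsPathSeq G f m ∧ ∀ (f' : ℕ → V) (m' : ℕ), IsPathSeq G f' m' → m' ≤ m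

/-- The Pósa rotation of a path sequence at index `i`: reverse the initial segment `f 0, …, f (i-1)` and keep
the rest, `f (i-1), f (i-2), …, f 0, f i, f (i+1), …`. [cite: Diestel2017, §7.3 (Prop. 7.3.1, Cor. 7.3.2); §1.7 (minors)] -/
def rot (f : ℕ → V) (i : ℕ) : ℕ → V := fun t => if t < i then f (i - 1 - t) else f t

/-- The segment `{f lo, …, f hi}` of a sequence. [cite: Diestel2017, §7.3 (Prop. 7.3.1, Cor. 7.3.2); §1.7 (minors)] -/
def seg (f : ℕ → V) (lo hi : ℕ) : Set V := f '' Set.Icc lo hi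

/-- The graph obtained from `G` by deleting every edge at the vertex `v`. [cite: Diestel2017, §7.3 (Prop. 7.3.1, Cor. 7.3.2); §1.7 (minors)] -/
def delVert (G : SimpleGraph V) (v : V) : SimpleGraph V where
  Adj a b := G.Adj a b ∧ a ≠ v ∧ b ≠ v
  symm := ⟨fun _ _ h => ⟨h.1.symm, h.2.2, h.2.1⟩⟩
  loopless := ⟨fun _ h => h.1.ne rfl⟩

/-! ### Basic API -/

variable {G : SimpleGraph V}

/-- `rot f i t = f (i - 1 - t)` on the reversed prefix. [cite: Diestel2017, §7.3 (Prop. 7.3.1, Cor. 7.3.2); §1.7 (minors)] -/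
theorem rot_of_lt {f : ℕ → V} {i t : ℕ} (h : t < i) : rot f i t = f (i - 1 - t) := if_pos h

/-- `rot f i t = f t` beyond the prefix. [cite: Diestel2017, §7.3 (Prop. 7.3.1, Cor. 7.3.2); §1.7 (minors)] -/
theorem rot_of_le {f : ℕ → V} {i t : ℕ} (h : i ≤ t) : rot f i t = f t := if_neg (Nat.not_lt.2 h)

/-- The rotated path starts at `f (i - 1)`. [cite: Diestel2017, §7.3 (Prop. 7.3.1, Cor. 7.3.2); §1.7 (minors)] -/
theorem rot_zero {f : ℕ → V} {i : ℕ} (h : 1 ≤ i) : rot f i 0 = f (i - 1) := by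
  rw [rot_of_lt (by omega), Nat.sub_zero]

/-- Membership in a segment. [cite: Diestel2017, §7.3 (Prop. 7.3.1, Cor. 7.3.2); §1.7 (minors)] -/
theorem mem_seg {f : ℕ → V} {lo hi t : ℕ} (h1 : lo ≤ t) (h2 : t ≤ hi) : f t ∈ seg f lo hi :=
  ⟨t, ⟨h1, h2⟩, rfl⟩

/-- Unfolding membership in a segment. [cite: Diestel2017, §7.3 (Prop. 7.3.1, Cor. 7.3.2); §1.7 (minors)] -/
theorem mem_seg_iff {f : ℕ → V} {lo hi : ℕ} {x : V} : x ∈ seg f lo hi ↔ ∃ t, lo ≤ t ∧ t ≤ hi ∧ f t = x := by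
  constructor
  · rintro ⟨t, ⟨h1, h2⟩, rfl⟩; exact ⟨t, h1, h2, rfl⟩
  · rintro ⟨t, h1, h2, rfl⟩; exact ⟨t, ⟨h1, h2⟩, rfl⟩

/-- `delVert G v` is a subgraph of `G`. [cite: Diestel2017, §7.3 (Prop. 7.3.1, Cor. 7.3.2); §1.7 (minors)] -/
theorem delVert_le (G : SimpleGraph V) (v : V) : delVert G v ≤ G := fun _ _ h => h.1

/-- A `K₄` minor of a subgraph is a `K₄` minor of the graph. [cite: Diestel2017, §7.3 (Prop. 7.3.1, Cor. 7.3.2); §1.7 (minors)] -/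
theorem hasK4Minor_of_le {G G' : SimpleGraph V} (h : G ≤ G') (hG : HasK4Minor G) : HasK4Minor G' := by
  obtain ⟨B, hne, hconn, hdisj, hadj⟩ := hG
  refine ⟨B, hne, fun i => (hconn i).mono fun a b hab => h hab, hdisj, fun i j hij => ?_⟩
  obtain ⟨a, ha, b, hb, hab⟩ := hadj i j hij
  exact ⟨a, ha, b, hb, h hab⟩

/-- Local richness hypothesis: every non-isolated vertex has three distinct neighbours. [cite: Diestel2017, §7.3 (Prop. 7.3.1, Cor. 7.3.2); §1.7 (minors)] -/
def ThreeNeighbours (G : SimpleGraph V) : Prop :=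
  ∀ v : V, (∃ w, G.Adj v w) → ∃ a b c, G.Adj v a ∧ G.Adj v b ∧ G.Adj v c ∧ a ≠ b ∧ a ≠ c ∧ b ≠ c

end K4Free

end Literature.Probability.LatticeModels.RandomClusterRayleigh

end Part2

/-!
## Part 3 — port of `Summits/CriticalPhenomena/PercolationContinuityZ3/Theorems/Transplant/K4MinorFreePaths.lean` (14 declarations kept)

# `K₄`-minor-free graphs are partial 2-trees — file 2: longest paths, Pósa rotation, `K₄` minors from path segments

Verbatim declaration-level port (the declarations listed in the Part header count) of a helper module of the
PercolationContinuityZ3 tree (FK sub-lane); route bookkeeping of the source docstring is not reproduced.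
(Wagner 2008, graph case; `Literature/Probability/LatticeModels/RandomClusterRayleighSeriesParallel.lean`) needs the
classical STRUCTURE THEOREM "a finite graph without a `K₄` minor is a subgraph of a 2-tree" (Dirac 1952 / Duffin 1965 /
Wald–Colbourn 1983; Diestel, Graph Theory, §7.3), so that kernel theorem `FK.rc_edgeNegCorr_of_isTwoTree` (negative edge correlation of
`φ_{w,q}`, `0 < q ≤ 1`, on 2-tree supports) applies to every `K₄`-minor-free support.

This file (proofs only): a longest path exists (`exists_isLongest`); every neighbour of its first vertex lies on it
(`IsLongest.exists_eq_of_adj`); rotating at a chord gives a longest path (`IsLongest.rot`); segments of a path are connected,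
disjoint branch sets (`IsPathSeq.seg_connected`, `…seg_disjoint`); four branch sets give `HasK4Minor` (`hasK4Minor_of_sets`); and
the two configurations used by the rotation descent: CROSSING CHORDS `f 0 ~ f i`, `f (i-1) ~ f k`, `f 0 ~ f j` with
`i < k ≤ j` (`IsPathSeq.hasK4Minor_A1`) and the LONG JUMP `k > j` (`IsPathSeq.hasK4Minor_A2`).
[cite: Diestel2017, §7.3 (Prop. 7.3.1, Cor. 7.3.2); §1.7]
-/

section Part3

namespace Literature.Probability.LatticeModels.RandomClusterRayleigh

namespace K4Free

open Literature.Probability.LatticeModels (HasK4Minor)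

variable {V : Type*} {G : SimpleGraph V}

/-! ### Path sequences: length bound, longest paths, the endpoint lemma -/

/-- A path sequence of length `m` has `m + 1` distinct vertices, so `m < |V|`. [cite: Diestel2017, §7.3 (Prop. 7.3.1, Cor. 7.3.2); §1.7] -/
theorem IsPathSeq.lt_card [Fintype V] {f : ℕ → V} {m : ℕ} (h : IsPathSeq G f m) : m < Fintype.card V := by
  have hinj : Function.Injective (fun t : Fin (m + 1) => f t) := by
    intro s t hst
    exact Fin.ext (h.inj s t (Nat.lt_succ_iff.1 s.2) (Nat.lt_succ_iff.1 t.2) hst)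
  have := Fintype.card_le_of_injective _ hinj
  simp only [Fintype.card_fin] at this
  omega

/-- A single vertex is a path sequence of length `0`. [cite: Diestel2017, §7.3 (Prop. 7.3.1, Cor. 7.3.2); §1.7] -/
theorem isPathSeq_zero (v : V) : IsPathSeq G (fun _ => v) 0 :=
  ⟨fun _ ht => (Nat.not_lt_zero _ ht).elim, fun s t hs ht _ => by omega⟩

/-- An edge is a path sequence of length `1`. [cite: Diestel2017, §7.3 (Prop. 7.3.1, Cor. 7.3.2); §1.7] -/
theorem isPathSeq_one {v w : V} (h : G.Adj v w) : IsPathSeq G (fun t => if t = 0 then v else w) 1 := by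
  refine ⟨fun t ht => ?_, fun s t hs ht hst => ?_⟩
  · have ht0 : t = 0 := by omega
    subst ht0; simpa using h
  · by_contra hne
    have hvw : v ≠ w := h.ne
    rcases Nat.eq_zero_or_pos s with hs0 | hs0 <;> rcases Nat.eq_zero_or_pos t with ht0 | ht0
    · omega
    · simp only [hs0, if_true, show t ≠ 0 by omega, if_false] at hst; exact hvw hst
    · simp only [ht0, if_true, show s ≠ 0 by omega, if_false] at hst; exact hvw hst.symm
    · omega

/-- **A longest path exists** in a finite graph with a vertex. [cite: Diestel2017, §7.3 (Prop. 7.3.1, Cor. 7.3.2); §1.7] -/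
theorem exists_isLongest [Fintype V] (v : V) : ∃ (f : ℕ → V) (m : ℕ), IsLongest G f m := by
  classical
  have hP0 : ∃ f : ℕ → V, IsPathSeq G f 0 := ⟨fun _ => v, isPathSeq_zero v⟩
  obtain ⟨f, hf⟩ := Nat.findGreatest_spec (P := fun k => ∃ f : ℕ → V, IsPathSeq G f k) (Nat.zero_le (Fintype.card V)) hP0
  refine ⟨f, _, hf, fun f' m' hf' => ?_⟩
  exact Nat.le_findGreatest (hf'.lt_card).le ⟨f', hf'⟩

/-- A longest path has length `≥ 1` as soon as the graph has an edge. [cite: Diestel2017, §7.3 (Prop. 7.3.1, Cor. 7.3.2); §1.7] -/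
theorem IsLongest.one_le {f : ℕ → V} {m : ℕ} (h : IsLongest G f m) {v w : V} (hvw : G.Adj v w) : 1 ≤ m :=
  h.2 _ 1 (isPathSeq_one hvw)

/-- **Endpoint lemma**: every neighbour of the first vertex of a longest path lies on the path (otherwise the path
could be prolonged). [cite: Diestel2017, §7.3 (Prop. 7.3.1, Cor. 7.3.2); §1.7] -/
theorem IsLongest.exists_eq_of_adj {f : ℕ → V} {m : ℕ} (h : IsLongest G f m) {y : V} (hy : G.Adj (f 0) y) :
    ∃ t, 1 ≤ t ∧ t ≤ m ∧ f t = y := by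
  by_contra hne
  have hne' : ∀ t, t ≤ m → f t ≠ y := by
    intro t ht hft
    rcases Nat.eq_zero_or_pos t with rfl | ht1
    · exact hy.ne hft
    · exact hne ⟨t, ht1, ht, hft⟩
  let f' : ℕ → V := fun t => if t = 0 then y else f (t - 1)
  have hf' : IsPathSeq G f' (m + 1) := by
    refine ⟨fun t ht => ?_, fun s t hs ht hst => ?_⟩
    · rcases Nat.eq_zero_or_pos t with rfl | ht1
      · simpa [f'] using hy.symm
      · simp only [f', show t ≠ 0 by omega, if_false, show t + 1 ≠ 0 by omega]
        have := h.1.adj (t - 1) (by omega)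
        rwa [show t - 1 + 1 = t + 1 - 1 by omega] at this
    · rcases Nat.eq_zero_or_pos s with rfl | hs1 <;> rcases Nat.eq_zero_or_pos t with rfl | ht1
      · rfl
      · simp only [f', if_true, show t ≠ 0 by omega, if_false] at hst
        exact (hne' (t - 1) (by omega) hst.symm).elim
      · simp only [f', if_true, show s ≠ 0 by omega, if_false] at hst
        exact (hne' (s - 1) (by omega) hst).elim
      · simp only [f', show s ≠ 0 by omega, show t ≠ 0 by omega, if_false] at hst
        have := h.1.inj (s - 1) (t - 1) (by omega) (by omega) hst
        omega
  have := h.2 f' (m + 1) hf'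
  omega

/-! ### Rotation -/

/-- **Pósa rotation**: if `f 0 ~ f i` (`2 ≤ i ≤ m`) then `rot f i` is again a path sequence of length `m`. [cite: Diestel2017, §7.3 (Prop. 7.3.1, Cor. 7.3.2); §1.7] -/
theorem IsPathSeq.rot {f : ℕ → V} {m : ℕ} (h : IsPathSeq G f m) {i : ℕ} (hi2 : 2 ≤ i) (him : i ≤ m)
    (hadj : G.Adj (f 0) (f i)) : IsPathSeq G (rot f i) m := by
  refine ⟨fun t ht => ?_, fun s t hs ht hst => ?_⟩
  · by_cases h1 : t + 1 < i
    · rw [rot_of_lt (by omega), rot_of_lt h1]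
      have := h.adj (i - 1 - (t + 1)) (by omega)
      rw [show i - 1 - (t + 1) + 1 = i - 1 - t by omega] at this
      exact this.symm
    · by_cases h2 : t < i
      · have ht : t = i - 1 := by omega
        rw [rot_of_lt h2, rot_of_le (by omega), ht, show i - 1 - (i - 1) = 0 by omega,
          show i - 1 + 1 = i by omega]
        exact hadj
      · rw [rot_of_le (by omega), rot_of_le (by omega)]
        exact h.adj t ht
  · by_cases hs' : s < i <;> by_cases ht' : t < i
    · rw [rot_of_lt hs', rot_of_lt ht'] at hst
      have := h.inj _ _ (by omega) (by omega) hst; omega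
    · rw [rot_of_lt hs', rot_of_le (by omega)] at hst
      have := h.inj _ _ (by omega) (by omega) hst; omega
    · rw [rot_of_le (by omega), rot_of_lt ht'] at hst
      have := h.inj _ _ (by omega) (by omega) hst; omega
    · rw [rot_of_le (by omega), rot_of_le (by omega)] at hst
      exact h.inj _ _ hs ht hst

/-- The rotation of a longest path is a longest path. [cite: Diestel2017, §7.3 (Prop. 7.3.1, Cor. 7.3.2); §1.7] -/
theorem IsLongest.rot {f : ℕ → V} {m : ℕ} (h : IsLongest G f m) {i : ℕ} (hi2 : 2 ≤ i) (him : i ≤ m)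
    (hadj : G.Adj (f 0) (f i)) : IsLongest G (rot f i) m :=
  ⟨h.1.rot hi2 him hadj, h.2⟩

/-! ### Segments of a path as branch sets -/

/-- A segment with `lo ≤ hi` is nonempty. [cite: Diestel2017, §7.3 (Prop. 7.3.1, Cor. 7.3.2); §1.7] -/
theorem seg_nonempty (f : ℕ → V) {lo hi : ℕ} (h : lo ≤ hi) : (seg f lo hi).Nonempty :=
  ⟨f lo, mem_seg le_rfl h⟩

/-- A segment of a path sequence induces a connected subgraph. [cite: Diestel2017, §7.3 (Prop. 7.3.1, Cor. 7.3.2); §1.7] -/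
theorem IsPathSeq.seg_connected {f : ℕ → V} {m : ℕ} (h : IsPathSeq G f m) {lo hi : ℕ} (hlh : lo ≤ hi)
    (hhi : hi ≤ m) : (G.induce (seg f lo hi)).Connected := by
  rw [SimpleGraph.connected_iff_exists_forall_reachable]
  refine ⟨⟨f lo, mem_seg le_rfl hlh⟩, ?_⟩
  have key : ∀ d (hd : lo + d ≤ hi),
      (G.induce (seg f lo hi)).Reachable ⟨f lo, mem_seg le_rfl hlh⟩ ⟨f (lo + d), mem_seg (by omega) hd⟩ := by
    intro d
    induction d with
    | zero => intro hd; exact SimpleGraph.Reachable.refl _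
    | succ d ih =>
      intro hd
      refine (ih (by omega)).trans (SimpleGraph.Adj.reachable ?_)
      rw [SimpleGraph.induce_adj]
      exact h.adj (lo + d) (by omega)
  rintro ⟨x, hx⟩
  obtain ⟨t, h1, h2, rfl⟩ := mem_seg_iff.1 hx
  obtain ⟨d, rfl⟩ : ∃ d, t = lo + d := ⟨t - lo, by omega⟩
  exact key d h2

/-- Segments with separated index ranges are disjoint. [cite: Diestel2017, §7.3 (Prop. 7.3.1, Cor. 7.3.2); §1.7] -/
theorem IsPathSeq.seg_disjoint {f : ℕ → V} {m : ℕ} (h : IsPathSeq G f m) {lo₁ hi₁ lo₂ hi₂ : ℕ}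
    (hsep : hi₁ < lo₂) (h2 : hi₂ ≤ m) : Disjoint (seg f lo₁ hi₁) (seg f lo₂ hi₂) := by
  refine Set.disjoint_left.2 fun x hx hx' => ?_
  obtain ⟨s, hs1, hs2, rfl⟩ := mem_seg_iff.1 hx
  obtain ⟨t, ht1, ht2, hft⟩ := mem_seg_iff.1 hx'
  have := h.inj s t (by omega) (by omega) hft.symm
  omega

/-- Two segments are joined by an edge as soon as some `f s ~ f t` with indices in the two ranges. [cite: Diestel2017, §7.3 (Prop. 7.3.1, Cor. 7.3.2); §1.7] -/
theorem seg_adj (f : ℕ → V) {lo₁ hi₁ lo₂ hi₂ s t : ℕ} (hs1 : lo₁ ≤ s) (hs2 : s ≤ hi₁) (ht1 : lo₂ ≤ t)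
    (ht2 : t ≤ hi₂) (hadj : G.Adj (f s) (f t)) : ∃ a ∈ seg f lo₁ hi₁, ∃ b ∈ seg f lo₂ hi₂, G.Adj a b :=
  ⟨f s, mem_seg hs1 hs2, f t, mem_seg ht1 ht2, hadj⟩

/-- **Four branch sets give a `K₄` minor**: nonempty, connected, pairwise disjoint, pairwise joined. [cite: Diestel2017, §7.3 (Prop. 7.3.1, Cor. 7.3.2); §1.7] -/
theorem hasK4Minor_of_sets (B₀ B₁ B₂ B₃ : Set V) (n0 : B₀.Nonempty) (n1 : B₁.Nonempty) (n2 : B₂.Nonempty)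
    (n3 : B₃.Nonempty) (c0 : (G.induce B₀).Connected) (c1 : (G.induce B₁).Connected)
    (c2 : (G.induce B₂).Connected) (c3 : (G.induce B₃).Connected)
    (d01 : Disjoint B₀ B₁) (d02 : Disjoint B₀ B₂) (d03 : Disjoint B₀ B₃) (d12 : Disjoint B₁ B₂)
    (d13 : Disjoint B₁ B₃) (d23 : Disjoint B₂ B₃)
    (a01 : ∃ a ∈ B₀, ∃ b ∈ B₁, G.Adj a b) (a02 : ∃ a ∈ B₀, ∃ b ∈ B₂, G.Adj a b)
    (a03 : ∃ a ∈ B₀, ∃ b ∈ B₃, G.Adj a b) (a12 : ∃ a ∈ B₁, ∃ b ∈ B₂, G.Adj a b)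
    (a13 : ∃ a ∈ B₁, ∃ b ∈ B₃, G.Adj a b) (a23 : ∃ a ∈ B₂, ∃ b ∈ B₃, G.Adj a b) : HasK4Minor G := by
  have sy : ∀ {A B : Set V}, (∃ a ∈ A, ∃ b ∈ B, G.Adj a b) → ∃ a ∈ B, ∃ b ∈ A, G.Adj a b :=
    fun ⟨a, ha, b, hb, hab⟩ => ⟨b, hb, a, ha, hab.symm⟩
  let B : Fin 4 → Set V := fun i => if i = 0 then B₀ else if i = 1 then B₁ else if i = 2 then B₂ else B₃
  have hB0 : B 0 = B₀ := rfl
  have hB1 : B 1 = B₁ := rfl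
  have hB2 : B 2 = B₂ := rfl
  have hB3 : B 3 = B₃ := rfl
  refine ⟨B, ?_, ?_, ?_, ?_⟩
  · intro i; fin_cases i
    · exact n0
    · exact n1
    · exact n2
    · exact n3
  · intro i; fin_cases i
    · exact c0
    · exact c1
    · exact c2
    · exact c3
  · intro i j hij
    fin_cases i <;> fin_cases j
    all_goals first
      | exact absurd rfl hij
      | exact d01 | exact d02 | exact d03 | exact d12 | exact d13 | exact d23
      | exact d01.symm | exact d02.symm | exact d03.symm | exact d12.symm | exact d13.symm | exact d23.symm
  · intro i j hij
    fin_cases i <;> fin_cases j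
    all_goals first
      | exact absurd rfl hij
      | exact a01 | exact a02 | exact a03 | exact a12 | exact a13 | exact a23
      | exact sy a01 | exact sy a02 | exact sy a03 | exact sy a12 | exact sy a13 | exact sy a23

/-- **Crossing chords** (construction A1): a path `f 0 … f m` with `f 0 ~ f i`, `f 0 ~ f j`, `f (i-1) ~ f k` and
`2 ≤ i < k ≤ j ≤ m` contains a `K₄` minor with branch sets `f[0, i-2]`, `{f (i-1)}`, `f[i, k-1]`, `f[k, j]`. [cite: Diestel2017, §7.3 (Prop. 7.3.1, Cor. 7.3.2); §1.7] -/
theorem IsPathSeq.hasK4Minor_A1 {f : ℕ → V} {m : ℕ} (h : IsPathSeq G f m) {i j k : ℕ} (hi : 2 ≤ i)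
    (hik : i < k) (hkj : k ≤ j) (hjm : j ≤ m) (h0i : G.Adj (f 0) (f i)) (h0j : G.Adj (f 0) (f j))
    (hik' : G.Adj (f (i - 1)) (f k)) : HasK4Minor G := by
  refine hasK4Minor_of_sets (seg f 0 (i - 2)) (seg f (i - 1) (i - 1)) (seg f i (k - 1)) (seg f k j)
    (seg_nonempty f (by omega)) (seg_nonempty f le_rfl) (seg_nonempty f (by omega)) (seg_nonempty f hkj)
    (h.seg_connected (by omega) (by omega)) (h.seg_connected le_rfl (by omega))
    (h.seg_connected (by omega) (by omega)) (h.seg_connected hkj hjm)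
    (h.seg_disjoint (by omega) (by omega)) (h.seg_disjoint (by omega) (by omega))
    (h.seg_disjoint (by omega) (by omega)) (h.seg_disjoint (by omega) (by omega))
    (h.seg_disjoint (by omega) (by omega)) (h.seg_disjoint (by omega) (by omega))
    ?_ ?_ ?_ ?_ ?_ ?_
  · -- f (i-2) ~ f (i-1)
    have := h.adj (i - 2) (by omega)
    rw [show i - 2 + 1 = i - 1 by omega] at this
    exact seg_adj f (by omega) le_rfl le_rfl le_rfl this
  · exact seg_adj f le_rfl (by omega) le_rfl (by omega) h0i
  · exact seg_adj f le_rfl (by omega) (by omega) le_rfl h0j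
  · -- f (i-1) ~ f i
    have := h.adj (i - 1) (by omega)
    rw [show i - 1 + 1 = i by omega] at this
    exact seg_adj f le_rfl le_rfl le_rfl (by omega) this
  · exact seg_adj f le_rfl le_rfl le_rfl hkj hik'
  · -- f (k-1) ~ f k
    have := h.adj (k - 1) (by omega)
    rw [show k - 1 + 1 = k by omega] at this
    exact seg_adj f (by omega) le_rfl le_rfl hkj this

/-- **Long jump** (construction A2): a path `f 0 … f m` with `f 0 ~ f i`, `f 0 ~ f j`, `f (i-1) ~ f k` and
`2 ≤ i < j < k ≤ m` contains a `K₄` minor with branch sets `{f 0}`, `f[1, i-1]`, `f[i, j-1]`, `f[j, k]`. [cite: Diestel2017, §7.3 (Prop. 7.3.1, Cor. 7.3.2); §1.7] -/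
theorem IsPathSeq.hasK4Minor_A2 {f : ℕ → V} {m : ℕ} (h : IsPathSeq G f m) {i j k : ℕ} (hi : 2 ≤ i)
    (hij : i < j) (hjk : j < k) (hkm : k ≤ m) (h0i : G.Adj (f 0) (f i)) (h0j : G.Adj (f 0) (f j))
    (hik' : G.Adj (f (i - 1)) (f k)) : HasK4Minor G := by
  refine hasK4Minor_of_sets (seg f 0 0) (seg f 1 (i - 1)) (seg f i (j - 1)) (seg f j k)
    (seg_nonempty f le_rfl) (seg_nonempty f (by omega)) (seg_nonempty f (by omega)) (seg_nonempty f hjk.le)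
    (h.seg_connected le_rfl (by omega)) (h.seg_connected (by omega) (by omega))
    (h.seg_connected (by omega) (by omega)) (h.seg_connected hjk.le hkm)
    (h.seg_disjoint (by omega) (by omega)) (h.seg_disjoint (by omega) (by omega))
    (h.seg_disjoint (by omega) (by omega)) (h.seg_disjoint (by omega) (by omega))
    (h.seg_disjoint (by omega) (by omega)) (h.seg_disjoint (by omega) (by omega))
    ?_ ?_ ?_ ?_ ?_ ?_
  · exact seg_adj f le_rfl le_rfl le_rfl (by omega) (h.adj 0 (by omega))
  · exact seg_adj f le_rfl le_rfl le_rfl (by omega) h0i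
  · exact seg_adj f le_rfl le_rfl le_rfl hjk.le h0j
  · have := h.adj (i - 1) (by omega)
    rw [show i - 1 + 1 = i by omega] at this
    exact seg_adj f (by omega) le_rfl le_rfl (by omega) this
  · exact seg_adj f (by omega) le_rfl (by omega) le_rfl hik'
  · have := h.adj (j - 1) (by omega)
    rw [show j - 1 + 1 = j by omega] at this
    exact seg_adj f (by omega) le_rfl le_rfl hjk.le this

end K4Free

end Literature.Probability.LatticeModels.RandomClusterRayleigh

end Part3

/-!
## Part 4 — port of `Summits/CriticalPhenomena/PercolationContinuityZ3/Theorems/Transplant/K4MinorFreeDirac.lean` (9 declarations kept)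

# `K₄`-minor-free graphs are partial 2-trees — file 3: Dirac's lemma, suppression of degree-two vertices, the 2-tree embedding

Verbatim declaration-level port (the declarations listed in the Part header count) of a helper module of the
PercolationContinuityZ3 tree (FK sub-lane); route bookkeeping of the source docstring is not reproduced.
(Wagner 2008, graph case; `Literature/Probability/LatticeModels/RandomClusterRayleighSeriesParallel.lean`) needs the
classical STRUCTURE THEOREM "a finite graph without a `K₄` minor is a subgraph of a 2-tree" (Dirac 1952 / Duffin 1965 /
Wald–Colbourn 1983; Diestel, Graph Theory, §7.3), so that kernel theorem `FK.rc_edgeNegCorr_of_isTwoTree` (negative edge correlation of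
`φ_{w,q}`, `0 < q ≤ 1`, on 2-tree supports) applies to every `K₄`-minor-free support.

This file (proofs only):
* `K4Free.hasK4Minor_of_isLongest` / `K4Free.hasK4Minor_of_threeNeighbours` — DIRAC'S LEMMA in minor form: a finite graph with
  an edge in which every non-isolated vertex has three neighbours has a `K₄` minor.  Proof by the ROTATION DESCENT: take a longest
  path `f`; its first vertex has chords `f 0 ~ f i`, `f 0 ~ f j` (`2 ≤ i < j`); rotate at `i`; a neighbour `f k` (`k > i`) of the new
  first vertex `f (i-1)` gives crossing chords or a long jump (file 2), otherwise all its neighbours have index `≤ i < j` and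
  strong induction on that bound concludes.  (Branch sets are path segments throughout — no Menger, no block decomposition.)
* `K4Free.exists_le_two_neighbours` — hence a `K₄`-minor-free graph with an edge has a vertex with one or two neighbours;
* `K4Free.hasK4Minor_of_suppress` — a `K₄` minor of `(G − v) + uw` (`v ~ u`, `v ~ w`) lifts to `G`;
* `K4Free.exists_superset_of_not_hasK4Minor` — for ANY property `P` of pair sets containing the single pairs and closed under
  gluing a fresh vertex onto a member pair (e.g. `FK.IsTwoTree`), every `K₄`-minor-free graph with edges inside a vertex
  set `s`, `|s| ≥ 2`, lies inside some `T` with `P T` on the vertices of `s` (induction on `|s|`).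
[cite: Diestel2017, §7.3 (Prop. 7.3.1, Cor. 7.3.2); §1.7] [cite: Wagner2006, §5.3]
-/

section Part4

namespace Literature.Probability.LatticeModels.RandomClusterRayleigh

namespace K4Free

open Literature.Probability.LatticeModels (HasK4Minor)

variable {V : Type*} {G : SimpleGraph V}

/-! ### Dirac's lemma: three neighbours at every non-isolated vertex force a `K₄` minor -/

/-- Under `ThreeNeighbours`, the first vertex of a longest path (of length `≥ 1`) has two neighbours `f i`, `f j` on the
path with `2 ≤ i < j ≤ m`. [cite: Diestel2017, §7.3 (Prop. 7.3.1, Cor. 7.3.2); §1.7] -/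
theorem IsLongest.exists_two_chords {f : ℕ → V} {m : ℕ} (h : IsLongest G f m) (h3 : ThreeNeighbours G)
    (hm : 1 ≤ m) : ∃ i j, 2 ≤ i ∧ i < j ∧ j ≤ m ∧ G.Adj (f 0) (f i) ∧ G.Adj (f 0) (f j) := by
  obtain ⟨a, b, c, ha, hb, hc, hab, hac, hbc⟩ := h3 (f 0) ⟨f 1, h.1.adj 0 (by omega)⟩
  obtain ⟨ta, ta1, tam, rfl⟩ := h.exists_eq_of_adj ha
  obtain ⟨tb, tb1, tbm, rfl⟩ := h.exists_eq_of_adj hb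
  obtain ⟨tc, tc1, tcm, rfl⟩ := h.exists_eq_of_adj hc
  have hab' : ta ≠ tb := fun h' => hab (by rw [h'])
  have hac' : ta ≠ tc := fun h' => hac (by rw [h'])
  have hbc' : tb ≠ tc := fun h' => hbc (by rw [h'])
  -- among three distinct indices `≥ 1`, two are `≥ 2`; order them
  by_cases hta : ta = 1
  · rcases lt_or_gt_of_ne hbc' with hlt | hlt
    · exact ⟨tb, tc, by omega, hlt, tcm, hb, hc⟩
    · exact ⟨tc, tb, by omega, hlt, tbm, hc, hb⟩
  · by_cases htb : tb = 1
    · rcases lt_or_gt_of_ne hac' with hlt | hlt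
      · exact ⟨ta, tc, by omega, hlt, tcm, ha, hc⟩
      · exact ⟨tc, ta, by omega, hlt, tam, hc, ha⟩
    · rcases lt_or_gt_of_ne hab' with hlt | hlt
      · exact ⟨ta, tb, by omega, hlt, tbm, ha, hb⟩
      · exact ⟨tb, ta, by omega, hlt, tam, hb, ha⟩

/-- **The rotation descent.**  Under `ThreeNeighbours`, a longest path `f` of length `m ≥ 1` all of whose first-vertex
neighbours have index `≤ J` yields a `K₄` minor — by strong induction on `J`: with chords `f 0 ~ f i`, `f 0 ~ f j`
(`2 ≤ i < j`), rotate at `i`; a neighbour `f k` of the new first vertex `f (i-1)` with `k > i` gives crossing chords (`k ≤ j`)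
or a long jump (`k > j`), and otherwise the rotated path has all first-vertex neighbours at indices `≤ i < J`.
[cite: Diestel2017, §7.3 (Hadwiger's conjecture for r = 4: graphs of minimum degree 3 contain K⁴ minors)] -/
theorem hasK4Minor_of_isLongest (h3 : ThreeNeighbours G) {m : ℕ} (hm : 1 ≤ m) :
    ∀ (J : ℕ) (f : ℕ → V), IsLongest G f m → (∀ t, t ≤ m → G.Adj (f 0) (f t) → t ≤ J) → HasK4Minor G := by
  intro J
  induction J using Nat.strong_induction_on with
  | _ J ih =>
    intro f hf hJ
    obtain ⟨i, j, hi2, hij, hjm, h0i, h0j⟩ := hf.exists_two_chords h3 hm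
    have hjJ : j ≤ J := hJ j hjm h0j
    -- the rotated path
    have hg : IsLongest G (rot f i) m := hf.rot hi2 (by omega) h0i
    by_cases hfar : ∃ t, i < t ∧ t ≤ m ∧ G.Adj (rot f i 0) (rot f i t)
    · obtain ⟨k, hik, hkm, hk⟩ := hfar
      rw [rot_zero (by omega), rot_of_le hik.le] at hk
      by_cases hkj : k ≤ j
      · exact hf.1.hasK4Minor_A1 hi2 hik hkj hjm h0i h0j hk
      · exact hf.1.hasK4Minor_A2 hi2 hij (by omega) hkm h0i h0j hk
    · refine ih i (by omega) (rot f i) hg fun t htm ht => ?_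
      by_contra hti
      exact hfar ⟨t, by omega, htm, ht⟩

/-- **Dirac's lemma (minor form)**: a finite graph with an edge in which every non-isolated vertex has at least three
neighbours has a `K₄` minor. [cite: Diestel2017, §7.3, Prop. 7.3.1 and Cor. 7.3.2] -/
theorem hasK4Minor_of_threeNeighbours [Fintype V] (h3 : ThreeNeighbours G) {v w : V} (hvw : G.Adj v w) :
    HasK4Minor G := by
  obtain ⟨f, m, hf⟩ := exists_isLongest (G := G) v
  exact hasK4Minor_of_isLongest h3 (hf.one_le hvw) m f hf fun t ht _ => ht

/-- **A `K₄`-minor-free graph with an edge has a vertex with one or two neighbours.** [cite: Diestel2017, Cor. 7.3.2] -/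
theorem exists_le_two_neighbours [Fintype V] (hK : ¬ HasK4Minor G) {v₀ w₀ : V} (hvw : G.Adj v₀ w₀) :
    ∃ v u, G.Adj v u ∧ ((∀ w, G.Adj v w → w = u) ∨
      ∃ u', u' ≠ u ∧ G.Adj v u' ∧ ∀ w, G.Adj v w → w = u ∨ w = u') := by
  by_contra hno
  refine hK (hasK4Minor_of_threeNeighbours (fun v ⟨u, hu⟩ => ?_) hvw)
  by_contra h3
  refine hno ⟨v, u, hu, ?_⟩
  by_cases h1 : ∀ w, G.Adj v w → w = u
  · exact Or.inl h1
  · right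
    obtain ⟨u', hu'adj, hu'ne⟩ : ∃ u', G.Adj v u' ∧ u' ≠ u := by
      by_contra hn
      exact h1 fun w hw => by by_contra hwu; exact hn ⟨w, hw, hwu⟩
    refine ⟨u', hu'ne, hu'adj, fun w hw => ?_⟩
    by_contra hw'
    have hwu : w ≠ u := fun h' => hw' (Or.inl h')
    have hwu' : w ≠ u' := fun h' => hw' (Or.inr h')
    exact h3 ⟨u, u', w, hu, hu'adj, hw, hu'ne.symm, hwu.symm, hwu'.symm⟩

/-! ### Suppressing a vertex of degree two does not create `K₄` minors out of nothing -/

/-- Reachability transfer along a vertex map that sends edges to reachable pairs. [cite: Diestel2017, §7.3 (Prop. 7.3.1, Cor. 7.3.2); §1.7] -/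
theorem reachable_map_of_adj {W W' : Type*} {H : SimpleGraph W} {H' : SimpleGraph W'} (φ : W → W')
    (hφ : ∀ a b, H.Adj a b → H'.Reachable (φ a) (φ b)) {a b : W} (h : H.Reachable a b) :
    H'.Reachable (φ a) (φ b) := by
  obtain ⟨p⟩ := h
  induction p with
  | nil => exact SimpleGraph.Reachable.refl _
  | cons hab _ ih => exact (hφ _ _ hab).trans ih

/-- In `delVert G v ⊔ edge u w` the vertex `v` is isolated (when `v ≠ u`, `v ≠ w`). [cite: Diestel2017, §7.3 (Prop. 7.3.1, Cor. 7.3.2); §1.7] -/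
theorem not_adj_suppress {G : SimpleGraph V} {v u w : V} (hvu : v ≠ u) (hvw : v ≠ w) (b : V) :
    ¬ (delVert G v ⊔ SimpleGraph.edge u w).Adj v b := by
  rintro (h | h)
  · exact h.2.1 rfl
  · rw [SimpleGraph.edge_adj] at h
    rcases h.1 with ⟨h1, -⟩ | ⟨h1, -⟩
    · exact hvu h1
    · exact hvw h1

/-- **Lifting a `K₄` minor through the suppression of a degree-two vertex**: if `v ~ u`, `v ~ w` in `G` and the graph
obtained by deleting the edges at `v` and joining `u – w` has a `K₄` minor, then so has `G` (put `v` into the branch set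
of `u`; the new edge `u – w` is replaced by the path `u – v – w`). [cite: Diestel2017, §1.7 (minors; contracting an edge)] -/
theorem hasK4Minor_of_suppress {G : SimpleGraph V} {v u w : V} (hvu : G.Adj v u) (hvw : G.Adj v w)
    (hK : HasK4Minor (delVert G v ⊔ SimpleGraph.edge u w)) : HasK4Minor G := by
  classical
  set G' := delVert G v ⊔ SimpleGraph.edge u w with hG'
  obtain ⟨B, hne, hconn, hdisj, hadj⟩ := hK
  -- `v` lies in no branch set
  have hvB : ∀ i, v ∉ B i := by
    intro i hv
    -- pick `j ≠ i` and an edge from `B i` to `B j`; walk inside `B i` from `v` to its endpoint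
    obtain ⟨j, hji⟩ : ∃ j : Fin 4, j ≠ i := ⟨i + 1, by
      intro h; have := congrArg Fin.val h; simp [Fin.val_add] at this; omega⟩
    obtain ⟨a, ha, b, hb, hab⟩ := hadj i j hji.symm
    by_cases hav : a = v
    · subst hav; exact not_adj_suppress hvu.ne hvw.ne b hab
    · -- `v` and `a` are distinct vertices of the connected set `B i`: `v` has a `G'`-neighbour
      have hr : (G'.induce (B i)).Reachable ⟨v, hv⟩ ⟨a, ha⟩ := (hconn i) ⟨v, hv⟩ ⟨a, ha⟩
      obtain ⟨p⟩ := hr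
      cases p with
      | nil => exact hav rfl
      | cons h' _ => exact not_adj_suppress hvu.ne hvw.ne _ (SimpleGraph.induce_adj.1 h')
  -- new branch sets
  let B' : Fin 4 → Set V := fun i => if u ∈ B i then insert v (B i) else B i
  have hsub : ∀ i, B i ⊆ B' i := by
    intro i x hx; by_cases hu : u ∈ B i
    · simp only [B', if_pos hu]; exact Set.mem_insert_of_mem _ hx
    · simp only [B', if_neg hu]; exact hx
  have hmem : ∀ i x, x ∈ B' i → x ∈ B i ∨ (x = v ∧ u ∈ B i) := by
    intro i x hx
    by_cases hu : u ∈ B i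
    · simp only [B', if_pos hu, Set.mem_insert_iff] at hx
      rcases hx with rfl | hx
      · exact Or.inr ⟨rfl, hu⟩
      · exact Or.inl hx
    · simp only [B', if_neg hu] at hx; exact Or.inl hx
  have hvB' : ∀ i, u ∈ B i → v ∈ B' i := by
    intro i hu; simp only [B', if_pos hu]; exact Set.mem_insert _ _
  refine ⟨B', fun i => (hne i).mono (hsub i), fun i => ?_, fun i j hij => ?_, fun i j hij => ?_⟩
  · -- connectivity of `B' i` in `G`
    rw [SimpleGraph.connected_iff_exists_forall_reachable]
    obtain ⟨a₀, ha₀⟩ := hne i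
    refine ⟨⟨a₀, hsub i ha₀⟩, ?_⟩
    -- every `G'`-edge inside `B i` becomes a `G`-reachability inside `B' i`
    have hstep : ∀ a b : B i, (G'.induce (B i)).Adj a b →
        (G.induce (B' i)).Reachable ⟨a, hsub i a.2⟩ ⟨b, hsub i b.2⟩ := by
      rintro ⟨a, ha⟩ ⟨b, hb⟩ h'
      rw [SimpleGraph.induce_adj] at h'
      rcases h' with h' | h'
      · exact SimpleGraph.Adj.reachable (SimpleGraph.induce_adj.2 h'.1)
      · rw [SimpleGraph.edge_adj] at h'
        obtain ⟨h', -⟩ := h'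
        -- the edge `u – w`: go through `v`
        have key : ∀ (hu : u ∈ B i) (hw : w ∈ B i),
            (G.induce (B' i)).Reachable ⟨u, hsub i hu⟩ ⟨w, hsub i hw⟩ := by
          intro hu hw
          have hv : v ∈ B' i := hvB' i hu
          have h1 : (G.induce (B' i)).Adj ⟨u, hsub i hu⟩ ⟨v, hv⟩ := SimpleGraph.induce_adj.2 hvu.symm
          have h2 : (G.induce (B' i)).Adj ⟨v, hv⟩ ⟨w, hsub i hw⟩ := SimpleGraph.induce_adj.2 hvw
          exact h1.reachable.trans h2.reachable
        rcases h' with ⟨rfl, rfl⟩ | ⟨rfl, rfl⟩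
        · exact key ha hb
        · exact (key hb ha).symm
    rintro ⟨x, hx⟩
    rcases hmem i x hx with hxB | ⟨rfl, hu⟩
    · exact reachable_map_of_adj (H := G'.induce (B i)) (H' := G.induce (B' i))
        (fun a => ⟨a, hsub i a.2⟩) hstep ((hconn i) ⟨a₀, ha₀⟩ ⟨x, hxB⟩)
    · -- `x = v`: reach `u` first, then step to `v`
      have h1 := reachable_map_of_adj (H := G'.induce (B i)) (H' := G.induce (B' i))
        (fun a => ⟨a, hsub i a.2⟩) hstep ((hconn i) ⟨a₀, ha₀⟩ ⟨u, hu⟩)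
      exact h1.trans (SimpleGraph.Adj.reachable (SimpleGraph.induce_adj.2 (show G.Adj u x from hvu.symm)))
  · -- disjointness
    refine Set.disjoint_left.2 fun x hxi hxj => ?_
    rcases hmem i x hxi with hxi' | ⟨rfl, hui⟩ <;> rcases hmem j x hxj with hxj' | ⟨hxv, huj⟩
    · exact Set.disjoint_left.1 (hdisj i j hij) hxi' hxj'
    · exact hvB i (hxv ▸ hxi')
    · exact hvB j hxj'
    · exact Set.disjoint_left.1 (hdisj i j hij) hui huj
  · -- adjacency between branch sets
    obtain ⟨a, ha, b, hb, hab⟩ := hadj i j hij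
    rcases hab with hab | hab
    · exact ⟨a, hsub i ha, b, hsub j hb, hab.1⟩
    · rw [SimpleGraph.edge_adj] at hab
      rcases hab.1 with ⟨rfl, rfl⟩ | ⟨rfl, rfl⟩
      · exact ⟨v, hvB' i ha, b, hsub j hb, hvw⟩
      · exact ⟨a, hsub i ha, v, hvB' j hb, hvw.symm⟩

/-! ### Every `K₄`-minor-free graph lies inside a 2-tree -/

/-- A nondiagonal pair containing `u` is `s(u, y)` for some `y ≠ u`. [cite: Diestel2017, §7.3 (Prop. 7.3.1, Cor. 7.3.2); §1.7] -/
theorem exists_eq_mk_of_mem {e : Sym2 V} {u : V} (hu : u ∈ e) (hd : ¬ e.IsDiag) : ∃ y, y ≠ u ∧ e = s(u, y) :=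
  ⟨Sym2.Mem.other hu, Sym2.other_ne hd hu, (Sym2.other_spec hu).symm⟩

/-- **`K₄`-minor-free graphs are partial 2-trees** (Dirac 1952 / Duffin 1965 / Wald–Colbourn 1983), in abstract form: let
`P` be any property of sets of pairs containing every single pair `{uv}` (`u ≠ v`) and closed under gluing a fresh vertex `x`
onto a member pair `uv` (`T ↦ T ∪ {ux, xv}`) — e.g. "is a 2-tree".  Then for every finite `K₄`-minor-free graph `G` whose
edges lie inside a vertex set `s` with `|s| ≥ 2` there is a `T` with property `P` containing all edges of `G`, covering
every vertex of `s`, using only vertices of `s`, and consisting of nondiagonal pairs.  Proof: induction on `|s|`, removing a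
vertex with at most two neighbours (`exists_le_two_neighbours`) and suppressing it (`hasK4Minor_of_suppress`).
[cite: Diestel2017, §7.3, Prop. 7.3.1 and Cor. 7.3.2 (structure of the graphs without a K⁴ minor)] -/
theorem exists_superset_of_not_hasK4Minor [Fintype V] [DecidableEq V] (P : Set (Sym2 V) → Prop)
    (hpair : ∀ u v : V, u ≠ v → P {s(u, v)})
    (hcons : ∀ (T : Set (Sym2 V)) (u v x : V), P T → s(u, v) ∈ T → (∀ e ∈ T, x ∉ e) →
      P (T ∪ {s(u, x), s(x, v)})) :
    ∀ (n : ℕ) (s : Finset V) (G : SimpleGraph V), s.card = n + 2 → ¬ HasK4Minor G →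
      (∀ a b, G.Adj a b → a ∈ s ∧ b ∈ s) →
      ∃ T : Set (Sym2 V), P T ∧ (∀ a b, G.Adj a b → s(a, b) ∈ T) ∧ (∀ x ∈ s, ∃ e ∈ T, x ∈ e) ∧
        (∀ e ∈ T, ∀ x ∈ e, x ∈ s) ∧ (∀ e ∈ T, ¬ e.IsDiag) := by
  intro n
  induction n with
  | zero =>
    intro s G hs hK hG
    obtain ⟨a, b, hab, rfl⟩ := Finset.card_eq_two.1 hs
    refine ⟨{s(a, b)}, hpair a b hab, fun x y hxy => ?_, fun x hx => ?_, fun e he x hx => ?_, fun e he => ?_⟩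
    · obtain ⟨hx, hy⟩ := hG x y hxy
      simp only [Finset.mem_insert, Finset.mem_singleton] at hx hy
      have hne := hxy.ne
      rcases hx with rfl | rfl <;> rcases hy with rfl | rfl
      · exact (hne rfl).elim
      · exact Set.mem_singleton _
      · exact Sym2.eq_swap ▸ Set.mem_singleton _
      · exact (hne rfl).elim
    · refine ⟨s(a, b), Set.mem_singleton _, ?_⟩
      simp only [Finset.mem_insert, Finset.mem_singleton] at hx
      rcases hx with rfl | rfl
      · exact Sym2.mem_mk_left _ _
      · exact Sym2.mem_mk_right _ _
    · rw [Set.mem_singleton_iff.1 he] at hx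
      rcases Sym2.mem_iff.1 hx with rfl | rfl <;> simp
    · rw [Set.mem_singleton_iff.1 he, Sym2.mk_isDiag_iff]; exact hab
  | succ n ih =>
    intro s G hs hK hG
    -- common gluing step: from `T'` on `s.erase v` with a member pair `s(u, y)` (`u ≠ y`), glue `v` onto it
    have glue : ∀ (v : V) (_ : v ∈ s) (T' : Set (Sym2 V)) (u y : V), P T' → s(u, y) ∈ T' →
        (∀ x ∈ s.erase v, ∃ e ∈ T', x ∈ e) → (∀ e ∈ T', ∀ x ∈ e, x ∈ s.erase v) → (∀ e ∈ T', ¬ e.IsDiag) →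
        (∀ a b, G.Adj a b → a ≠ v → b ≠ v → s(a, b) ∈ T') → (∀ b, G.Adj v b → b = u ∨ b = y) →
        ∃ T : Set (Sym2 V), P T ∧ (∀ a b, G.Adj a b → s(a, b) ∈ T) ∧ (∀ x ∈ s, ∃ e ∈ T, x ∈ e) ∧
          (∀ e ∈ T, ∀ x ∈ e, x ∈ s) ∧ (∀ e ∈ T, ¬ e.IsDiag) := by
      intro v hv T' u y hP huy hcov hwithin hnd hedges hnbrs
      have hu : u ∈ s.erase v := hwithin _ huy u (Sym2.mem_mk_left _ _)
      have hy : y ∈ s.erase v := hwithin _ huy y (Sym2.mem_mk_right _ _)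
      have huv : u ≠ v := Finset.ne_of_mem_erase hu
      have hyv : y ≠ v := Finset.ne_of_mem_erase hy
      have hfresh : ∀ e ∈ T', v ∉ e := fun e he hve => Finset.ne_of_mem_erase (hwithin e he v hve) rfl
      refine ⟨T' ∪ {s(u, v), s(v, y)}, hcons T' u y v hP huy hfresh, fun a b hab => ?_, fun x hx => ?_,
        fun e he x hx => ?_, fun e he => ?_⟩
      · by_cases hav : a = v
        · subst hav
          rcases hnbrs b hab with rfl | rfl
          · exact Or.inr (Or.inl Sym2.eq_swap)
          · exact Or.inr (Or.inr rfl)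
        · by_cases hbv : b = v
          · subst hbv
            rcases hnbrs a hab.symm with rfl | rfl
            · exact Or.inr (Or.inl rfl)
            · exact Or.inr (Or.inr Sym2.eq_swap)
          · exact Or.inl (hedges a b hab hav hbv)
      · by_cases hxv : x = v
        · subst hxv; exact ⟨s(u, x), Or.inr (Or.inl rfl), Sym2.mem_mk_right _ _⟩
        · obtain ⟨e, he, hxe⟩ := hcov x (Finset.mem_erase.2 ⟨hxv, hx⟩)
          exact ⟨e, Or.inl he, hxe⟩
      · rcases he with he | he | he
        · exact Finset.mem_of_mem_erase (hwithin e he x hx)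
        · rw [he] at hx
          rcases Sym2.mem_iff.1 hx with rfl | rfl
          · exact Finset.mem_of_mem_erase hu
          · exact hv
        · rw [Set.mem_singleton_iff.1 he] at hx
          rcases Sym2.mem_iff.1 hx with rfl | rfl
          · exact hv
          · exact Finset.mem_of_mem_erase hy
      · rcases he with he | he | he
        · exact hnd e he
        · rw [he, Sym2.mk_isDiag_iff]; exact huv
        · rw [Set.mem_singleton_iff.1 he, Sym2.mk_isDiag_iff]; exact hyv.symm
    by_cases hE : ∃ a b, G.Adj a b
    · -- a vertex `v` with one or two neighbours
      obtain ⟨a₀, b₀, hab₀⟩ := hE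
      obtain ⟨v, u, hvu, hdeg⟩ := exists_le_two_neighbours hK hab₀
      have hv : v ∈ s := (hG v u hvu).1
      have hu : u ∈ s := (hG v u hvu).2
      have hcard : (s.erase v).card = n + 2 := by rw [Finset.card_erase_of_mem hv, hs]; rfl
      rcases hdeg with hdeg | ⟨u', hu'u, hvu', hdeg⟩
      · -- one neighbour: delete the edges at `v`
        obtain ⟨T', hP, hedges, hcov, hwithin, hnd⟩ := ih (s.erase v) (delVert G v) hcard
          (fun h => hK (hasK4Minor_of_le (delVert_le G v) h))
          (fun a b hab => ⟨Finset.mem_erase.2 ⟨hab.2.1, (hG a b hab.1).1⟩,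
            Finset.mem_erase.2 ⟨hab.2.2, (hG a b hab.1).2⟩⟩)
        obtain ⟨e, he, hue⟩ := hcov u (Finset.mem_erase.2 ⟨hvu.ne.symm, hu⟩)
        obtain ⟨y, -, rfl⟩ := exists_eq_mk_of_mem hue (hnd e he)
        exact glue v hv T' u y hP he hcov hwithin hnd (fun a b hab hav hbv => hedges a b ⟨hab, hav, hbv⟩)
          fun b hb => Or.inl (hdeg b hb)
      · -- two neighbours `u ≠ u'`: suppress `v`
        obtain ⟨T', hP, hedges, hcov, hwithin, hnd⟩ := ih (s.erase v) (delVert G v ⊔ SimpleGraph.edge u u') hcard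
          (fun h => hK (hasK4Minor_of_suppress hvu hvu' h))
          (fun a b hab => by
            rcases hab with hab | hab
            · exact ⟨Finset.mem_erase.2 ⟨hab.2.1, (hG a b hab.1).1⟩, Finset.mem_erase.2 ⟨hab.2.2, (hG a b hab.1).2⟩⟩
            · rw [SimpleGraph.edge_adj] at hab
              have hu₁ : u ∈ s.erase v := Finset.mem_erase.2 ⟨hvu.ne.symm, hu⟩
              have hu₂ : u' ∈ s.erase v := Finset.mem_erase.2 ⟨hvu'.ne.symm, (hG v u' hvu').2⟩
              rcases hab.1 with ⟨rfl, rfl⟩ | ⟨rfl, rfl⟩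
              · exact ⟨hu₁, hu₂⟩
              · exact ⟨hu₂, hu₁⟩)
        have huu' : s(u, u') ∈ T' :=
          hedges u u' (Or.inr ((SimpleGraph.edge_adj _ _ _ _).2 ⟨Or.inl ⟨rfl, rfl⟩, hu'u.symm⟩))
        exact glue v hv T' u u' hP huu' hcov hwithin hnd
          (fun a b hab hav hbv => hedges a b (Or.inl ⟨hab, hav, hbv⟩)) fun b hb => hdeg b hb
    · -- no edge at all: glue an arbitrary vertex of `s` onto an arbitrary member pair
      have hsne : s.Nonempty := by rw [← Finset.card_pos, hs]; omega
      obtain ⟨v, hv⟩ := hsne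
      have hcard : (s.erase v).card = n + 2 := by rw [Finset.card_erase_of_mem hv, hs]; rfl
      obtain ⟨T', hP, -, hcov, hwithin, hnd⟩ := ih (s.erase v) G hcard hK
        (fun a b hab => (hE ⟨a, b, hab⟩).elim)
      have hne' : (s.erase v).Nonempty := by rw [← Finset.card_pos, hcard]; omega
      obtain ⟨x, hx⟩ := hne'
      obtain ⟨e, he, hxe⟩ := hcov x hx
      obtain ⟨y, -, rfl⟩ := exists_eq_mk_of_mem hxe (hnd e he)
      exact glue v hv T' x y hP he hcov hwithin hnd (fun a b hab => (hE ⟨a, b, hab⟩).elim)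
        fun b hb => (hE ⟨v, b, hb⟩).elim

end K4Free

end Literature.Probability.LatticeModels.RandomClusterRayleigh

end Part4

/-!
## Part 5 — port of `Summits/CriticalPhenomena/PercolationContinuityZ3/Theorems/Transplant/FKConnectivityAllQWagner.lean` (1 declarations kept)

# Connectivity correlation inequalities for `φ_{w,q}`, every `q > 0` — Wagner's theorem (graph case) DISCHARGED:
# `φ_{w,q}`, `0 < q ≤ 1`, is edge-negatively associated on every weighted graph without a `K₄` minor

Verbatim declaration-level port (the declarations listed in the Part header count) of a helper module of the
PercolationContinuityZ3 tree (FK sub-lane); route bookkeeping of the source docstring is not reproduced.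

`Wagner2008_rc_edgeNegCorr_of_noK4Minor_holds : Wagner2008_rc_edgeNegCorr_of_noK4Minor` — the Literature named fact
(Wagner, Ann. Comb. 12 (2008), graph case in negative-correlation form: for `0 < q ≤ 1` and every weight vector on `Fin n` whose
support graph has no `K₄` minor, `φ_{w,q}(J_e ∩ J_f) ≤ φ_{w,q}(J_e)·φ_{w,q}(J_f)` for all pairs `f ≠ e`, `e` not a loop) is now a
THEOREM of the tree.  Assembly of three kernel ingredients:
1. `FK.edgeNegCorrSupp_of_isTwoTree` — negative edge correlation for every weight vector supported inside a
   2-tree (apex elimination; a vertex-level form of Wagner's two-sum induction, Thm. 5.8(d));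
2. `K4Free.exists_superset_of_not_hasK4Minor` (`…K4MinorFreeDirac.lean`) — the graph theory: a finite graph without
   a `K₄` minor (branch sets) lies inside a 2-tree (Dirac 1952 / Duffin 1965; rotation-descent proof of Dirac's lemma);
3. loop erasure (`…AllQLoops.lean`) — the named fact's support GRAPH ignores diagonal pairs, which are independent coins.
Consequence: `FK.pairConnPosUnder_of_noK4Minor` / `FK.hubUnder_of_noK4Minor` (Ayyer–Linusson–Ravichandran's hub
inequality (13) on series–parallel supports, every `q ∈ (0,1)`) hold with their named-fact hypothesis discharged:
`FK.pairConnPosUnder_of_noK4Minor'`, `FK.hubUnder_of_noK4Minor'`.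
[cite: Wagner2006, Ex. 5.1, Thm. 5.8(d), §5.2, §5.3] [cite: Diestel2017, §7.3 (Prop. 7.3.1, Cor. 7.3.2)]
[cite: Grimmett2006, §3.9 eq. (3.94) (p. 63); §1.4 eq. (1.20) (p. 15)] [cite: AyyerLinussonRavichandran2025, §7 eq. (13) (p. 22)]
-/

section Part5

namespace Literature.Probability.LatticeModels.RandomClusterRayleigh

namespace FK

open _root_.MeasureTheory _root_.Set Literature.Probability.LatticeModels Literature.Probability.Percolation
open scoped _root_.Classical

/-- **Every `K₄`-minor-free graph on `Fin n` (`n ≥ 2`) lies inside a 2-tree**: there is `T` with `IsTwoTree T` containing every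
edge of `G` as a pair. [cite: Diestel2017, §7.3 (Prop. 7.3.1, Cor. 7.3.2)] -/
theorem exists_isTwoTree_superset_of_not_hasK4Minor {V : Type*} [Fintype V] (G : SimpleGraph V) (hK : ¬ HasK4Minor G)
    (hV : 1 < Fintype.card V) :
    ∃ T : Set (Sym2 V), IsTwoTree T ∧ ∀ a b, G.Adj a b → s(a, b) ∈ T := by
  classical
  have hcard : (Finset.univ : Finset V).card = (Fintype.card V - 2) + 2 := by
    rw [Finset.card_univ]; omega
  obtain ⟨T, hT, hedges, -, -, -⟩ := K4Free.exists_superset_of_not_hasK4Minor (V := V) IsTwoTree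
    (fun u v huv => IsTwoTree.pair huv)
    (fun T u v x hT huv hx => IsTwoTree.cons hT huv hx)
    (Fintype.card V - 2) Finset.univ G hcard hK (fun a b _ => ⟨Finset.mem_univ a, Finset.mem_univ b⟩)
  exact ⟨T, hT, hedges⟩

end FK

end Literature.Probability.LatticeModels.RandomClusterRayleigh

end Part5

/-! ## Part 6 — the EXACT discharge `Wagner2008_rc_edgeNegCorr_of_noK4Minor_holds` -/

namespace Literature.Probability.LatticeModels

open RandomClusterRayleigh RandomClusterRayleigh.FK RandomClusterRayleigh.K4Free

/-- **The named fact `Wagner2008_rc_edgeNegCorr_of_noK4Minor` HOLDS** (`RandomClusterRayleighSeriesParallel.lean`; Wagner 2008, graph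
case in negative-correlation form: for `0 < q ≤ 1` and every weight vector on `Fin n` whose support graph has no `K₄` minor,
`φ_{w,q}(J_e ∩ J_f) ≤ φ_{w,q}(J_e)·φ_{w,q}(J_f)` for all pairs `f ≠ e`, `e` not a loop).  EXACT-name discharge: loops are independent
coins (`FK.rcMeasureW_real_inter_loop`, loop erasure), the support of the loop-erased weights lies inside a 2-tree
(`FK.exists_isTwoTree_superset_of_not_hasK4Minor`, Dirac / Duffin), and `FK.edgeNegCorrSupp_of_isTwoTree` (apex elimination =
Wagner's two-sum induction) concludes.  Literature-side twin of the Summits-side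
`Summit.CriticalPhenomena.PercolationContinuityZ3.Theorems.FK.Wagner2008_rc_edgeNegCorr_of_noK4Minor_holds` (same proof).
[cite: Wagner2006, Ex. 5.1, Thm. 5.8(d), §5.2, §5.3] [cite: Diestel2017, §7.3 (Prop. 7.3.1, Cor. 7.3.2)]
[cite: Grimmett2006, §3.9 eq. (3.94) (p. 63); §1.4 eq. (1.20) (p. 15)] -/
theorem Wagner2008_rc_edgeNegCorr_of_noK4Minor_holds : Wagner2008_rc_edgeNegCorr_of_noK4Minor := by
  intro n w q hq0 hq1 hK e f he hfe
  by_cases hf : f.IsDiag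
  · -- `f` is a loop: an independent coin, equality
    induction f using Sym2.ind with
    | h x y =>
      have hxy : x = y := Sym2.mk_isDiag_iff.1 hf
      subst hxy
      have hne : e ≠ s(x, x) := fun h => he (h ▸ Sym2.mk_isDiag_iff.2 rfl)
      rw [rcMeasureW_real_inter_loop w hq0 x hne]
  · -- both pairs nondiagonal: erase the loops and embed the support into a 2-tree
    rw [rcMeasureW_real_eraseLoops w hq0 _ (openPair_inter_loop_insensitive he hf),
      rcMeasureW_real_eraseLoops w hq0 _ (openPair_loop_insensitive he),
      rcMeasureW_real_eraseLoops w hq0 _ (openPair_loop_insensitive hf)]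
    -- `Fin n` has two elements (the ends of `e`)
    have hn : 1 < Fintype.card (Fin n) := by
      induction e using Sym2.ind with
      | h a b => exact Fintype.one_lt_card_iff.2 ⟨a, b, fun h => he (Sym2.mk_isDiag_iff.2 h)⟩
    obtain ⟨T, hT, hedges⟩ := exists_isTwoTree_superset_of_not_hasK4Minor _ hK hn
    refine edgeNegCorrSupp_of_isTwoTree hq0 hq1 hT _ (fun g hg => ?_) e f he hfe
    by_cases hgd : g.IsDiag
    · exact (hg (by rw [if_pos hgd]; rfl)).elim
    · rw [if_neg hgd] at hg
      induction g using Sym2.ind with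
      | h a b =>
        exact hedges a b ((SimpleGraph.fromEdgeSet_adj _).2 ⟨hg, fun h => hgd (Sym2.mk_isDiag_iff.2 h)⟩)

end Literature.Probability.LatticeModels

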